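import Summits.Parity.GeneralizedHardyLittlewood.Theorems.BeyondDiagonalBeatsQuarter.OffDiagPrincipalCellBound
import Summits.Parity.GeneralizedHardyLittlewood.Theorems.BeyondDiagonalBeatsQuarter.OffDiagDualAssembly
import HarnessLib

/-!
# Route `PrimeLevelFamEdge`, crux K_B (stmt-Parity-20343), line `diagonal_kernel_split` rev 4, plan Ω,
# `OffDiagCoreTallCount` stage 2c (line lead 2026-08-28T17:02:08Z (2)): **the principal piece of ONE LEVEL in ledger
# form — `|levelBody q Δ′ (switchedCell K_P Hf q)| ≤ (4πq̂/q)·Σ_{r<q⁷}Σ_{l,m≤q̂^{Δ′}}|c_l c_m|·Σ_{d₁∣l,d₂∣m}Σ_{i near}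
# 2τ(ab)(1 + log H)⁴·2^{i₂+1}·(3/2)2^{i₁}·S_i(r+1)`**

`OffDiagCoreSplit.coreP G Hf Δ′ = Σ_{q∈G} levelBody q Δ′ (switchedCell K_P Hf q)` with the principal kernel
`K_P c A s h₁ q = levelPrincipal {q} 1 (switchMod c s h₁)`. Stage 2b (`OffDiagPrincipalCellBound.norm_switchedCell_principal_le`)
priced one switched cell; this file passes the bound through the common outer shell `levelBody`
(`−re(2q̂(2π/q)·Σ_{r,l,m} c_l c_m Σ_{d,i} ·)`):

* **`abs_levelBody_le`** — the generic shell inequality: if `‖T r l m d₁ d₂ i‖ ≤ b r l m d₁ d₂ i` on the ranges of the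
  level body, then `|levelBody q Δ′ T| ≤ (4πq̂/q)·Σ_{r<q⁷}Σ_{l,m ≤ ⌊q̂^{Δ′}⌋}|c_l c_m|·Σ_{d₁∣l}Σ_{d₂∣m}Σ_{i ∈ nearBoxes} b`
  (any cell function; reusable for `coreS`/`coreL`/`coreX`-type bodies);
* **`abs_levelBody_principal_le`** — with stage 2b's cell bound: for `q ≥ 2` and any `Hf`,
  `|levelBody q Δ′ (switchedCell K_P Hf q)| ≤ (4πq̂/q)·Σ_{r,l,m}|c_l c_m|·Σ_{d₁,d₂,i} 2τ((l/d₁)(m/d₂))(1 + log H)⁴·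
  2^{i₂+1}·((3/2)2^{i₁}·S_i(r+1))`, `H = Hf q d₁ d₂ (l/d₁) (m/d₂) (r+1) i`,
  `S_i(c) = (d₁d₂K₁K₂/4)^{−1/2}·W(d₁d₂K₁K₂/(4q̂²))·c⁻¹`;
* `abs_coreP_le_sum` — `|coreP G Hf Δ′| ≤ Σ_{q∈G} (that)` for a set of levels `G ∌ 0`.
Stage 2d turns the right side into `q^{(Δ′−1)/2 + O(δ) + ε}·mainScaleReal Δ′ q` under `Hf ≤ q^{A₀}` (the «a8P ≈ U × L»
kernel number). Bounds only; no def; helper toward `stub_offDiagBelowSlack_io` (`--supports stmt-Parity-20343`);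
closes nothing; standard axioms.
«The programme SEARCHES and TYPES; no claim about Landau–Siegel zeros, Theorems 1–2 of arXiv:2211.02515 or
a repaired Margin232 until a kernel theorem says so.»
-/

noncomputable section

open Real Complex Finset Polynomial
open scoped FourierTransform

namespace Summit.Parity.GeneralizedHardyLittlewood.Theorems.BeyondDiagonalBeatsQuarter.OffDiag

open Literature.NumberTheory.LFunctions Literature.NumberTheory.LFunctions.KMV2000
open Literature.NumberTheory.Sieve.FriedlanderIwaniecPrimes (fourier2)
open PeterssonSplit (nearBoxes)

/-! ### §1. The shell inequality of the level body -/

/-- **The shell inequality.** For any cell function `T` and any majorant `b` of `‖T‖` on the ranges of the level body: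
`|levelBody q Δ′ T| ≤ (4πq̂/q)·Σ_{r<q⁷} Σ_{l,m ≤ ⌊q̂^{Δ′}⌋} |c_l c_m|·Σ_{d₁∣l} Σ_{d₂∣m} Σ_{i ∈ nearBoxes q d₁ d₂ (log q)⁴} b r l m d₁ d₂ i`
(`|re z| ≤ ‖z‖`, `‖2q̂(2π/q)‖ = 4πq̂/q`, triangle inequality). [folklore] -/
theorem abs_levelBody_le (q : ℕ) [NeZero q] (Δ' : ℝ) (T : ℕ → ℕ → ℕ → ℕ → ℕ → ℕ × ℕ → ℂ)
    (b : ℕ → ℕ → ℕ → ℕ → ℕ → ℕ × ℕ → ℝ)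
    (hb : ∀ r ∈ Finset.range (q ^ 7), ∀ l ∈ Icc 1 ⌊qhat q ^ Δ'⌋₊, ∀ m ∈ Icc 1 ⌊qhat q ^ Δ'⌋₊,
      ∀ d₁ ∈ l.divisors, ∀ d₂ ∈ m.divisors, ∀ i ∈ nearBoxes q d₁ d₂ (Real.log q ^ 4),
        ‖T r l m d₁ d₂ i‖ ≤ b r l m d₁ d₂ i) :
    |levelBody q Δ' T| ≤ 4 * π * qhat q / q *
      ∑ r ∈ Finset.range (q ^ 7), ∑ l ∈ Icc 1 ⌊qhat q ^ Δ'⌋₊, ∑ m ∈ Icc 1 ⌊qhat q ^ Δ'⌋₊,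
        |mollifierCoeff (X ^ 2) (qhat q ^ Δ') l * mollifierCoeff (X ^ 2) (qhat q ^ Δ') m| *
          ∑ d₁ ∈ l.divisors, ∑ d₂ ∈ m.divisors, ∑ i ∈ nearBoxes q d₁ d₂ (Real.log q ^ 4), b r l m d₁ d₂ i := by
  classical
  unfold levelBody
  have hpre : ‖(2 * (qhat q : ℂ) * (2 * π / q))‖ = 4 * π * qhat q / q := by
    have hq0 : (0 : ℝ) < q := by exact_mod_cast Nat.pos_of_ne_zero (NeZero.ne q)
    have hs0 : 0 ≤ qhat q := (qhat_pos_of_neZero q).le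
    rw [show (2 * (qhat q : ℂ) * (2 * π / q)) = ((4 * π * qhat q / q : ℝ) : ℂ) by push_cast; ring,
      Complex.norm_real, Real.norm_of_nonneg (by positivity)]
  rw [abs_neg]
  refine (Complex.abs_re_le_norm _).trans ?_
  rw [norm_mul, hpre]
  refine mul_le_mul_of_nonneg_left ?_ (by
    have hs0 : 0 ≤ qhat q := (qhat_pos_of_neZero q).le
    positivity)
  refine (norm_sum_le _ _).trans (Finset.sum_le_sum fun r hr ↦ ?_)
  refine (norm_sum_le _ _).trans (Finset.sum_le_sum fun l hl ↦ ?_)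
  refine (norm_sum_le _ _).trans (Finset.sum_le_sum fun m hm ↦ ?_)
  rw [norm_mul, Complex.norm_real, Real.norm_eq_abs]
  refine mul_le_mul_of_nonneg_left ?_ (abs_nonneg _)
  refine (norm_sum_le _ _).trans (Finset.sum_le_sum fun d₁ hd₁ ↦ ?_)
  refine (norm_sum_le _ _).trans (Finset.sum_le_sum fun d₂ hd₂ ↦ ?_)
  exact (norm_sum_le _ _).trans (Finset.sum_le_sum fun i hi ↦ hb r hr l hl m hm d₁ hd₁ d₂ hd₂ i hi)

/-! ### §2. The principal piece of one level, ledger form -/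

/-- **The principal piece of one level in ledger form.** For `q ≥ 2` and any height function `Hf`:
`|levelBody q Δ′ (switchedCell K_P Hf q)| ≤ (4πq̂/q)·Σ_{r<q⁷} Σ_{l,m ≤ ⌊q̂^{Δ′}⌋} |c_l c_m|·Σ_{d₁∣l} Σ_{d₂∣m} Σ_{i near}
   2τ((l/d₁)(m/d₂))·(1 + log Hf q d₁ d₂ (l/d₁) (m/d₂) (r+1) i)⁴·(2^{i₂+1}·((3/2)·2^{i₁}·S_i(r+1)))`
(stage 2b `norm_switchedCell_principal_le` in the shell `abs_levelBody_le`). With `G ∌ 0`, summing over `q ∈ G` bounds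
`|coreP G Hf Δ′|`. [cite: KowalskiMichelVanderKam2000, §6 p. 19, (21)–(23) p. 12 — derivation] -/
theorem abs_levelBody_principal_le (q : ℕ) [NeZero q] (hq : 2 ≤ q) (Δ' : ℝ)
    (Hf : ℕ → ℕ → ℕ → ℕ → ℕ → ℕ → ℕ × ℕ → ℕ) :
    |levelBody q Δ' (switchedCell (fun c _ s h₁ q ↦ levelPrincipal {q} (fun _ ↦ (1 : ℂ)) (switchMod c s h₁)) Hf q)| ≤
      4 * π * qhat q / q *
        ∑ r ∈ Finset.range (q ^ 7), ∑ l ∈ Icc 1 ⌊qhat q ^ Δ'⌋₊, ∑ m ∈ Icc 1 ⌊qhat q ^ Δ'⌋₊,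
          |mollifierCoeff (X ^ 2) (qhat q ^ Δ') l * mollifierCoeff (X ^ 2) (qhat q ^ Δ') m| *
            ∑ d₁ ∈ l.divisors, ∑ d₂ ∈ m.divisors, ∑ i ∈ nearBoxes q d₁ d₂ (Real.log q ^ 4),
              2 * ((((l / d₁) * (m / d₂) : ℕ)).divisors.card : ℝ) *
                (1 + Real.log (Hf q d₁ d₂ (l / d₁) (m / d₂) (r + 1) i)) ^ 4 *
                ((2 : ℝ) ^ (i.2 + 1) * (3 / 2 * (2 : ℝ) ^ i.1 *
                  (((d₁ : ℝ) * d₂ * ((2 : ℝ) ^ i.1 * 2 ^ i.2) / 4) ^ (-(1 / 2 : ℝ)) *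
                    cutoffW ((d₁ : ℝ) * d₂ * ((2 : ℝ) ^ i.1 * 2 ^ i.2) / 4 / qhat q ^ 2) *
                      (((r + 1 : ℕ) : ℝ))⁻¹ * 1))) := by
  refine abs_levelBody_le q Δ' _ _ fun r _ l hl m hm d₁ hd₁ d₂ hd₂ i _ ↦ ?_
  have hl1 : 1 ≤ l := (Finset.mem_Icc.mp hl).1
  have hm1 : 1 ≤ m := (Finset.mem_Icc.mp hm).1
  exact norm_switchedCell_principal_le hq Hf (Nat.pos_of_mem_divisors hd₁) (Nat.pos_of_mem_divisors hd₂)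
    (OffDiagDual.one_le_div_of_dvd (Nat.dvd_of_mem_divisors hd₁) hl1)
    (OffDiagDual.one_le_div_of_dvd (Nat.dvd_of_mem_divisors hd₂) hm1) i

/-- **`coreP` over a block of nonzero levels is bounded by the sum of the per-level bounds**: for any real `F` with
`|levelBody q Δ′ (switchedCell K_P Hf q)| ≤ F q` for every `q ∈ G` (`0 ∉ G`), `|coreP G Hf Δ′| ≤ Σ_{q∈G} F q`.
[folklore] -/
theorem abs_coreP_le_sum (G : Finset ℕ) (hG : ∀ q ∈ G, q ≠ 0) (Hf : ℕ → ℕ → ℕ → ℕ → ℕ → ℕ → ℕ × ℕ → ℕ)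
    (Δ' : ℝ) (F : ℕ → ℝ)
    (hF : ∀ q ∈ G, ∀ _ : NeZero q,
      |levelBody q Δ' (switchedCell (fun c _ s h₁ q ↦ levelPrincipal {q} (fun _ ↦ (1 : ℂ)) (switchMod c s h₁))
        Hf q)| ≤ F q) :
    |coreP G Hf Δ'| ≤ ∑ q ∈ G, F q := by
  unfold coreP coreWith
  refine (Finset.abs_sum_le_sum_abs _ _).trans (Finset.sum_le_sum fun q hq ↦ ?_)
  rw [dif_neg (hG q hq)]
  exact hF q hq ⟨hG q hq⟩

end Summit.Parity.GeneralizedHardyLittlewood.Theorems.BeyondDiagonalBeatsQuarter.OffDiag
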